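import Summits.BirchSwinnertonDyer.BirchSwinnertonDyer.Theorems.UniversalToricDescentLevelNineKernelLattice

/-!
# Level-`9` saturation: a subgroup of `GL₂(ℤ/9ℤ)` onto `GL₂(𝔽₃)` with full determinant and ONE
# non-scalar element `≡ 1 (mod 3)` is everything

Route `UniversalToricDescent` (BirchSwinnertonDyer), `--supports` crux stmt-BirchSwinnertonDyer-20695
`TwinSplitIMCAtThreeGoodSS` (the `3`-adic-image delta of the `p = 3` Howard/Castella–Wan port, seat memo
SUPSET-AT3-v8 §1(d)); namespace `Summit.BirchSwinnertonDyer.BirchSwinnertonDyer.Theorems.LevelNine`;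
theorems only (no definition, no named fact); route-free group theory. Serre's
lemma (1968, Ch. IV §3.4, Lemma 3) says that for `p ≥ 5` a closed subgroup of `GL₂(ℤ_p)` mapping
onto `GL₂(𝔽_p)` with full determinant is everything
(`Serre1968.generalLinearGroup_eq_top_of_map_surjective`); at `p = 3` this is FALSE — Serre's
Exercise / Elkies 2006: there is a subgroup `G' < GL₂(ℤ/9ℤ)` of index `27` mapping onto `GL₂(𝔽₃)`
with full determinant, realised as the mod-`9` image of infinitely many elliptic curves over `ℚ`
(`j = 4374, 419904, …`) — and one must start at level `9`
(`Serre1968.generalLinearGroup_eq_top_of_map_sq_surjective`). The present file proves the sharp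
intermediate criterion at level `9`, which is how `3`-adic surjectivity is verified in practice
from mod-`3` data plus ONE local element:

* `LevelNine.kernel_mem_of_nonscalar` — if `H ≤ GL₂(ℤ/9ℤ)` maps onto `GL₂(𝔽₃)` and contains an
  element `g₀ ≡ 1 (mod 3)` which is not a scalar matrix, then `1 + 3C ∈ H` for every `C` with
  `3 tr C = 0` (the kernel lattice of `H` contains `𝔰𝔩₂(𝔽₃)`): conjugation by `diag(-1,1)` and by
  the unipotents and differences turn the class of `g₀` into `E₁₂`, `E₂₁`, `diag(2,1)`.
* `LevelNine.mem_of_map_eq_one_of_det_eq_one` — hence `ker(GL₂(ℤ/9ℤ) → GL₂(𝔽₃)) ∩ SL₂ ≤ H`;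
  `LevelNine.exists_mem_det_eq_one_map_eq` — every element of `SL₂(𝔽₃)` has a lift in `H` of
  determinant `1` (the unipotents are commutators `[diag(2,1), u] = u`, hence in `H`, and `SL₂(𝔽₃)`
  is generated by their reductions in at most four letters, `sl_two_factor_of_ne_zero`).
* `LevelNine.generalLinearGroup_nine_eq_top_of_nonscalar` — **the saturation theorem**: (i) onto
  `GL₂(𝔽₃)`, (ii) `det` onto `(ℤ/9ℤ)ˣ`, (iii) one non-scalar element in the level-`3` kernel ⟹
  `H = GL₂(ℤ/9ℤ)`. Neither (ii) (`{det = ±1}`) nor (iii) (Elkies' `G'`) can be dropped.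

Elkies §1 (held text p. 2): his `G'` meets the level-`3` kernel in the scalars `{1, 4, 7}` —
the case excluded by (iii). Application: `UniversalToricDescentThreeAdicImageOfNonscalarKernel`.
References: [SerreAbelianLadic1968] Ch. IV §3.4, Lemma 3 and Exercises; [Elkies2006ThreeAdic]
arXiv:math/0612734 §0–§1 (held `paper:arxiv-math_0612734`). BSD is not proved by any of this.
-/

open scoped MatrixGroups

set_option linter.dupNamespace false
set_option autoImplicit false

namespace Summit.BirchSwinnertonDyer.BirchSwinnertonDyer.Theorems.LevelNine

open Matrix

/-! ### Saturation of the kernel lattice from ONE non-scalar element -/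

section Saturation

variable {H : Subgroup (GL (Fin 2) (ZMod 9))}

/-- From `1 + 3·(0 m; 0 0) ∈ H` with `3m ≠ 0` to `1 + 3·E₁₂ ∈ H`. [folklore] -/
theorem kernel_upper_of_multiple {m : ZMod 9} (hm : 3 * m ≠ 0)
    (hQ : ∃ h ∈ H, (h : Matrix (Fin 2) (Fin 2) (ZMod 9)) = 1 + (3 : ZMod 9) • !![0, m; 0, 0]) :
    ∃ h ∈ H, (h : Matrix (Fin 2) (Fin 2) (ZMod 9)) = 1 + (3 : ZMod 9) • !![0, 1; 0, 0] := by
  rcases three_mul_eq_three_or_six m hm with h3 | h6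
  · refine kernel_congr hQ ?_
    ext i j; fin_cases i <;> fin_cases j <;> simp [h3]
  · refine kernel_congr (kernel_nsmul_mem hQ 2) ?_
    ext i j; fin_cases i <;> fin_cases j <;> simp
    linear_combination 2 * h6 + nine_eq_zero_zmod

/-- **Saturation.** If `H ≤ GL₂(ℤ/9ℤ)` maps onto `GL₂(𝔽₃)` and contains ONE element
`g₀ ≡ 1 (mod 3)` which is not a scalar matrix, then `H` contains `1 + 3C` for EVERY `C` with
`3·tr C = 0`, i.e. the whole of `1 + 3·𝔰𝔩₂(𝔽₃) ⊂ GL₂(ℤ/9ℤ)`. Mechanism: the classes `C mod 3` with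
`1 + 3C ∈ H` form an `𝔽₃`-subspace of `M₂(𝔽₃)` stable under conjugation by `GL₂(𝔽₃)`
(`kernel_conj_mem`); conjugating the non-scalar class by `diag(-1,1)` and `(1 1; 0 1)` and taking
differences produces a non-zero multiple of `E₁₂`, whence `E₂₁` (by the swap) and `diag(2,1) ≡ h`
(by the lower unipotent), which span `𝔰𝔩₂(𝔽₃)`. (Serre 1968, IV §3.4, Exercises; the group
`G'` of Elkies 2006 §1 — onto `GL₂(𝔽₃)` with kernel the scalars `{1, 4, 7}` — shows the
non-scalar hypothesis cannot be dropped.) [folklore] -/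
theorem kernel_mem_of_nonscalar
    (hπ : ∀ t : GL (Fin 2) (ZMod 3), ∃ h ∈ H,
      Matrix.GeneralLinearGroup.map (ZMod.castHom three_dvd_nine (ZMod 3)) h = t)
    {g₀ : GL (Fin 2) (ZMod 9)} (hg₀ : g₀ ∈ H)
    (hg₀1 : Matrix.GeneralLinearGroup.map (ZMod.castHom three_dvd_nine (ZMod 3)) g₀ = 1)
    (hns : ∀ k : ZMod 9, (g₀ : Matrix (Fin 2) (Fin 2) (ZMod 9)) ≠ k • (1 : Matrix (Fin 2) (Fin 2) (ZMod 9)))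
    (C : Matrix (Fin 2) (Fin 2) (ZMod 9)) (htr : 3 * C 0 0 + 3 * C 1 1 = 0) :
    ∃ h ∈ H, (h : Matrix (Fin 2) (Fin 2) (ZMod 9)) = 1 + (3 : ZMod 9) • C := by
  obtain ⟨C₀, hC₀⟩ := exists_coe_eq_one_add_three_smul g₀ hg₀1
  have hQ₀ : ∃ h ∈ H, (h : Matrix (Fin 2) (Fin 2) (ZMod 9)) = 1 + (3 : ZMod 9) • C₀ :=
    ⟨g₀, hg₀, hC₀⟩
  obtain ⟨u, hu, hu'⟩ := exists_upper_unipotent_nine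
  obtain ⟨l, hl, hl'⟩ := exists_lower_unipotent_nine
  obtain ⟨D, hD, hD'⟩ := exists_diag_neg_one_nine
  obtain ⟨w, hw, hw'⟩ := exists_swap_nine
  obtain ⟨a, b, c, d, hC₀eta⟩ : ∃ a b c d : ZMod 9, C₀ = !![a, b; c, d] :=
    ⟨C₀ 0 0, C₀ 0 1, C₀ 1 0, C₀ 1 1, Matrix.eta_fin_two C₀⟩
  subst hC₀eta
  -- the non-scalar hypothesis, on entries
  have hns' : ¬ (3 * b = 0 ∧ 3 * c = 0 ∧ 3 * a = 3 * d) := by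
    rintro ⟨hb, hc, had⟩
    refine hns (1 + 3 * a) ?_
    rw [hC₀]
    ext i j; fin_cases i <;> fin_cases j <;> simp [hb, hc, had]
  -- Step 1: `E₁₂`
  have hDstep : ∃ h ∈ H, (h : Matrix (Fin 2) (Fin 2) (ZMod 9)) =
      1 + (3 : ZMod 9) • !![0, b; c, 0] := by
    have h1 := kernel_sub_mem (kernel_conj_mem hπ hQ₀ D) hQ₀
    rw [hD, hD', diag_conj_sub] at h1
    refine kernel_congr h1 ?_
    ext i j; fin_cases i <;> fin_cases j
    · simp; linear_combination (21 * a) * nine_eq_zero_zmod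
    · simp; linear_combination (2 * b) * nine_eq_zero_zmod
    · simp; linear_combination (2 * c) * nine_eq_zero_zmod
    · simp
  have hE12 : ∃ h ∈ H, (h : Matrix (Fin 2) (Fin 2) (ZMod 9)) =
      1 + (3 : ZMod 9) • !![0, 1; 0, 0] := by
    by_cases hc : 3 * c = 0
    · by_cases hb : 3 * b = 0
      · -- `C₀ ≡ diag(a, d)` with `3a ≠ 3d`: conjugate by the upper unipotent
        have had : 3 * a ≠ 3 * d := fun h ↦ hns' ⟨hb, hc, h⟩
        have h1 := kernel_sub_mem (kernel_conj_mem hπ hQ₀ u) hQ₀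
        rw [hu, hu', upper_conj_sub] at h1
        refine kernel_upper_of_multiple (m := 2 * a + d) ?_ (kernel_congr h1 ?_)
        · intro h0
          apply had
          linear_combination (-1 : ZMod 9) * h0 + a * nine_eq_zero_zmod
        · ext i j; fin_cases i <;> fin_cases j
          · simp [hc]
          · simp; linear_combination (2 * a) * nine_eq_zero_zmod + 8 * hc
          · simp
          · simp; linear_combination 8 * hc
      · -- `3b ≠ 0 = 3c`
        refine kernel_upper_of_multiple (m := b) hb (kernel_congr hDstep ?_)
        ext i j; fin_cases i <;> fin_cases j <;> simp [hc]
    · -- `3c ≠ 0`: upper unipotent, then the diagonal involution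
      have h2 := kernel_sub_mem (kernel_conj_mem hπ hDstep u) hDstep
      rw [hu, hu', upper_conj_sub] at h2
      have h3 := kernel_sub_mem (kernel_conj_mem hπ h2 D) h2
      rw [hD, hD', diag_conj_sub] at h3
      refine kernel_upper_of_multiple (m := 2 * c) ?_ (kernel_congr h3 ?_)
      · intro h0
        apply hc
        linear_combination (-1 : ZMod 9) * h0 + c * nine_eq_zero_zmod
      · ext i j; fin_cases i <;> fin_cases j
        · simp; linear_combination (21 * c) * nine_eq_zero_zmod
        · simp; linear_combination (18 * c) * nine_eq_zero_zmod
        · simp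
        · simp
  -- Step 2: `E₂₁` by the swap
  have hE21 : ∃ h ∈ H, (h : Matrix (Fin 2) (Fin 2) (ZMod 9)) =
      1 + (3 : ZMod 9) • !![0, 0; 1, 0] := by
    have h1 := kernel_conj_mem hπ hE12 w
    rw [hw, hw'] at h1
    have e : !![(0 : ZMod 9), 1; 1, 0] * !![0, 1; 0, 0] * !![0, 1; 1, 0] = !![0, 0; 1, 0] := by
      decide
    rwa [e] at h1
  -- Step 3: the diagonal class `diag(2, 1)` by the lower unipotent
  have hDiag : ∃ h ∈ H, (h : Matrix (Fin 2) (Fin 2) (ZMod 9)) =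
      1 + (3 : ZMod 9) • !![2, 0; 0, 1] := by
    have h1 := kernel_conj_mem hπ hE12 l
    rw [hl, hl'] at h1
    have e : !![(1 : ZMod 9), 0; 1, 1] * !![0, 1; 0, 0] * !![1, 0; 8, 1] = !![8, 1; 8, 1] := by
      decide
    rw [e] at h1
    have h2 := kernel_sub_mem (kernel_sub_mem h1 hE12) (kernel_nsmul_mem hE21 8)
    refine kernel_congr h2 ?_
    ext i j; fin_cases i <;> fin_cases j
    · simp; linear_combination 2 * nine_eq_zero_zmod
    · simp
    · simp
    · simp
  -- Step 4: assemble `C ≡ d'·diag(2,1) + b'·E₁₂ + c'·E₂₁ (mod 3)` using `3a' + 3d' = 0`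
  obtain ⟨a', b', c', d', rfl⟩ : ∃ a' b' c' d' : ZMod 9, C = !![a', b'; c', d'] :=
    ⟨C 0 0, C 0 1, C 1 0, C 1 1, Matrix.eta_fin_two C⟩
  have htr' : 3 * a' + 3 * d' = 0 := by simpa using htr
  have hsum := kernel_add_mem (kernel_add_mem (kernel_nsmul_mem hDiag d'.val)
    (kernel_nsmul_mem hE12 b'.val)) (kernel_nsmul_mem hE21 c'.val)
  refine kernel_congr hsum ?_
  ext i j; fin_cases i <;> fin_cases j
  · simp; linear_combination (-1 : ZMod 9) * htr' + d' * nine_eq_zero_zmod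
  · simp
  · simp
  · simp

end Saturation

/-! ### From the saturated kernel to `SL₂(ℤ/9ℤ) ≤ H` and `H = GL₂(ℤ/9ℤ)` -/

section Main

variable {H : Subgroup (GL (Fin 2) (ZMod 9))}

/-- Under the saturation hypotheses, every `g ≡ 1 (mod 3)` of determinant `1` lies in `H`
(`det (1 + 3C) = 1 + 3 tr C`). [folklore] -/
theorem mem_of_map_eq_one_of_det_eq_one
    (hπ : ∀ t : GL (Fin 2) (ZMod 3), ∃ h ∈ H,
      Matrix.GeneralLinearGroup.map (ZMod.castHom three_dvd_nine (ZMod 3)) h = t)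
    {g₀ : GL (Fin 2) (ZMod 9)} (hg₀ : g₀ ∈ H)
    (hg₀1 : Matrix.GeneralLinearGroup.map (ZMod.castHom three_dvd_nine (ZMod 3)) g₀ = 1)
    (hns : ∀ k : ZMod 9, (g₀ : Matrix (Fin 2) (Fin 2) (ZMod 9)) ≠ k • (1 : Matrix (Fin 2) (Fin 2) (ZMod 9)))
    (g : GL (Fin 2) (ZMod 9))
    (hg1 : Matrix.GeneralLinearGroup.map (ZMod.castHom three_dvd_nine (ZMod 3)) g = 1)
    (hgdet : Matrix.GeneralLinearGroup.det g = 1) : g ∈ H := by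
  obtain ⟨C, hC⟩ := exists_coe_eq_one_add_three_smul g hg1
  have hdet : (g : Matrix (Fin 2) (Fin 2) (ZMod 9)).det = 1 := by
    rw [← Matrix.GeneralLinearGroup.val_det_apply, hgdet, Units.val_one]
  rw [hC, det_one_add_three_smul] at hdet
  have htr : 3 * C 0 0 + 3 * C 1 1 = 0 := by linear_combination hdet
  obtain ⟨h, hh, e⟩ := kernel_mem_of_nonscalar hπ hg₀ hg₀1 hns C htr
  have : h = g := Units.ext (by rw [e, hC])
  exact this ▸ hh

/-- Under the saturation hypotheses, an `x` of determinant `1` with `δ x δ⁻¹ x⁻¹ = x` for some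
`δ ∈ GL₂(ℤ/9ℤ)` lies in `H`: the same commutator of LIFTS of `δ̄, x̄` in `H` has determinant `1`
and reduces to `x̄`, so it differs from `x` by an element `≡ 1 (mod 3)` of determinant `1`.
[folklore] -/
theorem mem_of_det_eq_one_of_commutator_eq
    (hπ : ∀ t : GL (Fin 2) (ZMod 3), ∃ h ∈ H,
      Matrix.GeneralLinearGroup.map (ZMod.castHom three_dvd_nine (ZMod 3)) h = t)
    {g₀ : GL (Fin 2) (ZMod 9)} (hg₀ : g₀ ∈ H)
    (hg₀1 : Matrix.GeneralLinearGroup.map (ZMod.castHom three_dvd_nine (ZMod 3)) g₀ = 1)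
    (hns : ∀ k : ZMod 9, (g₀ : Matrix (Fin 2) (Fin 2) (ZMod 9)) ≠ k • (1 : Matrix (Fin 2) (Fin 2) (ZMod 9)))
    (x δ : GL (Fin 2) (ZMod 9)) (hx : Matrix.GeneralLinearGroup.det x = 1)
    (hcomm : δ * x * δ⁻¹ * x⁻¹ = x) : x ∈ H := by
  obtain ⟨hδ, hhδ, eδ⟩ := hπ (Matrix.GeneralLinearGroup.map (ZMod.castHom three_dvd_nine (ZMod 3)) δ)
  obtain ⟨hx', hhx, ex⟩ := hπ (Matrix.GeneralLinearGroup.map (ZMod.castHom three_dvd_nine (ZMod 3)) x)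
  have hcH : hδ * hx' * hδ⁻¹ * hx'⁻¹ ∈ H :=
    H.mul_mem (H.mul_mem (H.mul_mem hhδ hhx) (H.inv_mem hhδ)) (H.inv_mem hhx)
  have hcred : Matrix.GeneralLinearGroup.map (ZMod.castHom three_dvd_nine (ZMod 3))
      (hδ * hx' * hδ⁻¹ * hx'⁻¹) =
      Matrix.GeneralLinearGroup.map (ZMod.castHom three_dvd_nine (ZMod 3)) x := by
    conv_rhs => rw [← hcomm]
    simp only [map_mul, map_inv, eδ, ex]
  have hcdet : Matrix.GeneralLinearGroup.det (hδ * hx' * hδ⁻¹ * hx'⁻¹) = 1 := by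
    simp only [map_mul, map_inv]
    rw [mul_comm (Matrix.GeneralLinearGroup.det hδ), mul_inv_cancel_right, mul_inv_cancel]
  have hsH : x⁻¹ * (hδ * hx' * hδ⁻¹ * hx'⁻¹) ∈ H := by
    refine mem_of_map_eq_one_of_det_eq_one hπ hg₀ hg₀1 hns _ ?_ ?_
    · rw [map_mul, map_inv, hcred, inv_mul_cancel]
    · rw [map_mul, map_inv, hcdet, hx, inv_one, one_mul]
  have hxeq : x = (hδ * hx' * hδ⁻¹ * hx'⁻¹) * (x⁻¹ * (hδ * hx' * hδ⁻¹ * hx'⁻¹))⁻¹ := by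
    rw [_root_.mul_inv_rev, inv_inv, mul_inv_cancel_left]
  rw [hxeq]
  exact H.mul_mem hcH (H.inv_mem hsH)

/-- Factorisation of a determinant-one `2 × 2` matrix over `𝔽₃` with non-zero lower-left entry
into three elementary matrices. [folklore] -/
theorem sl_two_factor_of_ne_zero (a b c d : ZMod 3) (hdet : a * d - b * c = 1) (hc : c ≠ 0) :
    !![a, b; c, d] =
      !![1, (a - 1) * c⁻¹; 0, 1] * !![1, 0; c, 1] * !![1, (d - 1) * c⁻¹; 0, 1] := by
  have hci : c * c⁻¹ = 1 := mul_inv_cancel₀ hc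
  ext i j; fin_cases i <;> fin_cases j
  · simp; linear_combination (1 - a) * hci
  · simp; linear_combination (-c⁻¹) * hdet + (-(b + (a - 1) * (d - 1) * c⁻¹)) * hci
  · simp
  · simp; linear_combination (1 - d) * hci

/-- Under the saturation hypotheses, every element of `SL₂(𝔽₃)` lifts to an element of `H` of
determinant `1`: the unipotents `u = (1 1; 0 1)` and `l = (1 0; 1 1)` of `GL₂(ℤ/9ℤ)` are
commutators `[diag(2,1), u] = u`, `[diag(1,2), l] = l`, hence lie in `H`
(`mem_of_det_eq_one_of_commutator_eq`), and every element of `SL₂(𝔽₃)` is a word of length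
`≤ 4` in `ū^x, l̄^z` (`sl_two_factor_of_ne_zero`). [folklore] -/
theorem exists_mem_det_eq_one_map_eq
    (hπ : ∀ t : GL (Fin 2) (ZMod 3), ∃ h ∈ H,
      Matrix.GeneralLinearGroup.map (ZMod.castHom three_dvd_nine (ZMod 3)) h = t)
    {g₀ : GL (Fin 2) (ZMod 9)} (hg₀ : g₀ ∈ H)
    (hg₀1 : Matrix.GeneralLinearGroup.map (ZMod.castHom three_dvd_nine (ZMod 3)) g₀ = 1)
    (hns : ∀ k : ZMod 9, (g₀ : Matrix (Fin 2) (Fin 2) (ZMod 9)) ≠ k • (1 : Matrix (Fin 2) (Fin 2) (ZMod 9)))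
    (t : GL (Fin 2) (ZMod 3)) (ht : Matrix.GeneralLinearGroup.det t = 1) :
    ∃ g ∈ H, Matrix.GeneralLinearGroup.map (ZMod.castHom three_dvd_nine (ZMod 3)) g = t ∧
      Matrix.GeneralLinearGroup.det g = 1 := by
  obtain ⟨u, hu, hu'⟩ := exists_upper_unipotent_nine
  obtain ⟨l, hl, hl'⟩ := exists_lower_unipotent_nine
  obtain ⟨δ₁, hδ₁, hδ₁'⟩ :=
    exists_generalLinearGroup_coe_eq !![2, 0; 0, 1] !![5, 0; 0, 1] (by decide) (by decide)
  obtain ⟨δ₂, hδ₂, hδ₂'⟩ :=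
    exists_generalLinearGroup_coe_eq !![1, 0; 0, 2] !![1, 0; 0, 5] (by decide) (by decide)
  have hudet : Matrix.GeneralLinearGroup.det u = 1 := Units.ext (by
    rw [Matrix.GeneralLinearGroup.val_det_apply, hu, Matrix.det_fin_two_of, Units.val_one]; ring)
  have hldet : Matrix.GeneralLinearGroup.det l = 1 := Units.ext (by
    rw [Matrix.GeneralLinearGroup.val_det_apply, hl, Matrix.det_fin_two_of, Units.val_one]; ring)
  have huH : u ∈ H := mem_of_det_eq_one_of_commutator_eq hπ hg₀ hg₀1 hns u δ₁ hudet
    (Units.ext (by rw [Units.val_mul, Units.val_mul, Units.val_mul, hδ₁, hu, hδ₁', hu']; decide))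
  have hlH : l ∈ H := mem_of_det_eq_one_of_commutator_eq hπ hg₀ hg₀1 hns l δ₂ hldet
    (Units.ext (by rw [Units.val_mul, Units.val_mul, Units.val_mul, hδ₂, hl, hδ₂', hl']; decide))
  -- powers of the unipotents and their reductions
  have hupow : ∀ n : ℕ, ((u ^ n : GL (Fin 2) (ZMod 9)) : Matrix (Fin 2) (Fin 2) (ZMod 9)) =
      !![1, (n : ZMod 9); 0, 1] := by
    intro n
    induction n with
    | zero => rw [pow_zero, Units.val_one, Nat.cast_zero]; exact Matrix.one_fin_two
    | succ n ih =>
      rw [pow_succ, Units.val_mul, ih, hu, Nat.cast_succ]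
      ext i j; fin_cases i <;> fin_cases j <;> simp [add_comm]
  have hlpow : ∀ n : ℕ, ((l ^ n : GL (Fin 2) (ZMod 9)) : Matrix (Fin 2) (Fin 2) (ZMod 9)) =
      !![1, 0; (n : ZMod 9), 1] := by
    intro n
    induction n with
    | zero => rw [pow_zero, Units.val_one, Nat.cast_zero]; exact Matrix.one_fin_two
    | succ n ih =>
      rw [pow_succ, Units.val_mul, ih, hl, Nat.cast_succ]
      ext i j; fin_cases i <;> fin_cases j <;> simp
  have hured : ∀ x : ZMod 3,
      ((Matrix.GeneralLinearGroup.map (ZMod.castHom three_dvd_nine (ZMod 3)) (u ^ x.val) :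
        GL (Fin 2) (ZMod 3)) : Matrix (Fin 2) (Fin 2) (ZMod 3)) = !![1, x; 0, 1] := by
    intro x
    rw [coe_map_castHom, hupow]
    ext i j; fin_cases i <;> fin_cases j <;> simp
  have hlred : ∀ z : ZMod 3,
      ((Matrix.GeneralLinearGroup.map (ZMod.castHom three_dvd_nine (ZMod 3)) (l ^ z.val) :
        GL (Fin 2) (ZMod 3)) : Matrix (Fin 2) (Fin 2) (ZMod 3)) = !![1, 0; z, 1] := by
    intro z
    rw [coe_map_castHom, hlpow]
    ext i j; fin_cases i <;> fin_cases j <;> simp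
  -- the word `u^x l^z u^y`
  have hword : ∀ x z y : ZMod 3,
      (u ^ x.val * l ^ z.val * u ^ y.val) ∈ H ∧
      ((Matrix.GeneralLinearGroup.map (ZMod.castHom three_dvd_nine (ZMod 3))
          (u ^ x.val * l ^ z.val * u ^ y.val) : GL (Fin 2) (ZMod 3)) :
            Matrix (Fin 2) (Fin 2) (ZMod 3)) =
        !![1, x; 0, 1] * !![1, 0; z, 1] * !![1, y; 0, 1] ∧
      Matrix.GeneralLinearGroup.det (u ^ x.val * l ^ z.val * u ^ y.val) = 1 := by
    intro x z y
    refine ⟨H.mul_mem (H.mul_mem (H.pow_mem huH _) (H.pow_mem hlH _)) (H.pow_mem huH _), ?_, ?_⟩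
    · rw [map_mul, map_mul, Units.val_mul, Units.val_mul, hured, hlred, hured]
    · simp only [map_mul, map_pow, hudet, hldet, one_pow, mul_one]
  -- entries of `t`
  obtain ⟨a, b, c, d, hteta⟩ : ∃ a b c d : ZMod 3,
      ((t : GL (Fin 2) (ZMod 3)) : Matrix (Fin 2) (Fin 2) (ZMod 3)) = !![a, b; c, d] :=
    ⟨_, _, _, _, Matrix.eta_fin_two _⟩
  have hdet' : a * d - b * c = 1 := by
    have h := congrArg (fun v : (ZMod 3)ˣ ↦ (v : ZMod 3)) ht
    simp only [Matrix.GeneralLinearGroup.val_det_apply, hteta, Matrix.det_fin_two_of,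
      Units.val_one] at h
    exact h
  by_cases hc : c = 0
  · -- lower-left entry zero: `t = l̄² · (ū^x l̄^a ū^y)` for the factorisation of `l̄ t`
    subst hc
    have ha : a ≠ 0 := by
      rintro rfl
      simp at hdet'
    have hdet'' : a * (b + d) - b * a = 1 := by linear_combination hdet'
    have h30 : (3 : ZMod 3) = 0 := by decide
    obtain ⟨hwH, hwred, hwdet⟩ := hword ((a - 1) * a⁻¹) a ((b + d - 1) * a⁻¹)
    refine ⟨l ^ (2 : ZMod 3).val * (u ^ ((a - 1) * a⁻¹).val * l ^ a.val * u ^ ((b + d - 1) * a⁻¹).val),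
      H.mul_mem (H.pow_mem hlH _) hwH, ?_, ?_⟩
    · apply Units.ext
      rw [map_mul, Units.val_mul, hlred, hwred, ← sl_two_factor_of_ne_zero a b a (b + d) hdet'' ha,
        hteta]
      ext i j; fin_cases i <;> fin_cases j
      · simp
      · simp
      · simp; linear_combination a * h30
      · simp; linear_combination b * h30
    · rw [map_mul, hwdet, mul_one, map_pow, hldet, one_pow]
  · obtain ⟨hwH, hwred, hwdet⟩ := hword ((a - 1) * c⁻¹) c ((d - 1) * c⁻¹)
    refine ⟨_, hwH, ?_, hwdet⟩
    apply Units.ext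
    rw [hwred, ← sl_two_factor_of_ne_zero a b c d hdet' hc, hteta]

/-- **Level-`9` saturation theorem.** Let `H ≤ GL₂(ℤ/9ℤ)` be a subgroup such that
(i) `H → GL₂(ℤ/3ℤ)` is onto, (ii) `det : H → (ℤ/9ℤ)ˣ` is onto, and (iii) `H` contains an element
`g₀ ≡ 1 (mod 3)` which is NOT a scalar matrix. Then `H = GL₂(ℤ/9ℤ)`. With Serre's lemma from level
`9` (`Serre1968.generalLinearGroup_eq_top_of_map_sq_surjective`, `p = 3`) this is the criterion «a closed
subgroup of `GL₂(ℤ₃)` onto `GL₂(𝔽₃)` with full determinant and one non-scalar element in the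
level-`3` kernel is everything»; hypothesis (iii) cannot be dropped (Elkies' group: onto `GL₂(𝔽₃)`,
full determinant, kernel = the scalars `{1, 4, 7}`, index `27`), and (ii) cannot be dropped
(`{g : det g ∈ {±1}}`). Proof: saturation of the kernel (`kernel_mem_of_nonscalar`) puts
`ker(GL₂(ℤ/9) → GL₂(𝔽₃)) ∩ SL₂` inside `H`; the unipotents are commutators, so `SL₂(ℤ/9ℤ) ≤ H`
(`exists_mem_det_eq_one_map_eq` + `mem_of_map_eq_one_of_det_eq_one`); (ii) finishes.
[cite: SerreAbelianLadic1968, Ch. IV §3.4, Lemma 3 and Exercises] [cite: Elkies2006ThreeAdic, §0–§1] -/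
theorem generalLinearGroup_nine_eq_top_of_nonscalar (H : Subgroup (GL (Fin 2) (ZMod 9)))
    (hπ : ∀ t : GL (Fin 2) (ZMod 3), ∃ h ∈ H,
      Matrix.GeneralLinearGroup.map (ZMod.castHom three_dvd_nine (ZMod 3)) h = t)
    (hdet : ∀ v : (ZMod 9)ˣ, ∃ h ∈ H, Matrix.GeneralLinearGroup.det h = v)
    {g₀ : GL (Fin 2) (ZMod 9)} (hg₀ : g₀ ∈ H)
    (hg₀1 : Matrix.GeneralLinearGroup.map (ZMod.castHom three_dvd_nine (ZMod 3)) g₀ = 1)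
    (hns : ∀ k : ZMod 9, (g₀ : Matrix (Fin 2) (Fin 2) (ZMod 9)) ≠ k • (1 : Matrix (Fin 2) (Fin 2) (ZMod 9))) :
    H = ⊤ := by
  rw [eq_top_iff]
  intro g _
  obtain ⟨h, hh, hhdet⟩ := hdet (Matrix.GeneralLinearGroup.det g)
  have hsdet : Matrix.GeneralLinearGroup.det (h⁻¹ * g) = 1 := by
    rw [map_mul, map_inv, hhdet, inv_mul_cancel]
  have htdet : Matrix.GeneralLinearGroup.det
      (Matrix.GeneralLinearGroup.map (ZMod.castHom three_dvd_nine (ZMod 3)) (h⁻¹ * g)) = 1 := by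
    apply Units.ext
    rw [Matrix.GeneralLinearGroup.val_det_apply, coe_map_castHom, ← RingHom.mapMatrix_apply,
      ← RingHom.map_det, ← Matrix.GeneralLinearGroup.val_det_apply, hsdet, Units.val_one, map_one,
      Units.val_one]
  obtain ⟨c, hcH, hcred, hcdet⟩ := exists_mem_det_eq_one_map_eq hπ hg₀ hg₀1 hns _ htdet
  have hs'H : c⁻¹ * (h⁻¹ * g) ∈ H := by
    refine mem_of_map_eq_one_of_det_eq_one hπ hg₀ hg₀1 hns _ ?_ ?_
    · rw [map_mul, map_inv, hcred, inv_mul_cancel]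
    · rw [map_mul, map_inv, hcdet, hsdet, inv_one, one_mul]
  have hg : g = h * (c * (c⁻¹ * (h⁻¹ * g))) := by
    rw [mul_inv_cancel_left, mul_inv_cancel_left]
  rw [hg]
  exact H.mul_mem hh (H.mul_mem hcH hs'H)

end Main

end Summit.BirchSwinnertonDyer.BirchSwinnertonDyer.Theorems.LevelNine
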